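import Literature.NumberTheory.Automorphic.UnitaryThreeUnipotentConjugacy   -- ★ rank-free §1 (isotropic fixed vector) + conjugation bookkeeping (F0P3a-p08 (g17))
import HarnessLib

/-!
# The unipotent classes of the quasi-split unitary group in two variables `U(1,1) = U(Φ₂)` (Rogawski 1990, §1.9–§1.10, §3.9; the `H`-side of §4.9)

Topic `NumberTheory/Automorphic`; namespace `Literature.NumberTheory.Automorphic.UnitaryGroup`.  THEOREMS ONLY (no definition, no instance, no notation,
no named fact, no `sorry`).  Cell `pub/hodgecm-mathlib` (D-0151), crux H413 = `stmt-HodgeConjecture-24833`, line «N6nsGerm», residue `stub_N6nsS3id` (transfer at the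
identity for `(G′_v, H_v) = (U(3), U(1,1) × U(1))` = Shalika germs on BOTH groups; CENSUS «S3» v2 (M1)∕(M3), architect A-p16 (g28): «`H_v`: classes `(1²)×1`,
`(2)×1`»; co-reader MEMO S3-T0 §N6: realisability spans the stable orbital integrals over «three unipotent classes `1, u_±` of `U(1,1)`»).  The rank-2 twin of
★ `UnitaryThreeSingularUnipotentClasses` (g16) + ★ `UnitaryThreeUnipotentConjugacy` (g17): the INDEX SET of the germ expansion on the `H`-side factor `U(Φ₂)`
(the tree's `U(J₂)`, cf. ★ `UnitaryGroupLineUnipotentTwo`: «the unipotent radical of the Borel of `U(J₂)` is `n(b) = 1 + b E₀₁`, `b + c b = 0`»), in tree currency: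
`{1} ∪ {n(t) : t ∈ (E⁰ ∖ 0) ∕ N E^×}`.  Written by F0P3a-p08 (g17).  HONEST LABEL: HC_CM is proved only modulo the printed citations (the 2 remaining named inputs
hLiu418, h413) until rung 0 closes; elementary (sesqui)linear algebra only.

SETTING (★ `UnitaryAntidiagFrames`): an arbitrary field `K`, a ring endomorphism `σ` (an involution where stated), `J₀ = (StdForm.antidiagonal 2).over K`,
`U(σ, J₀) =` ★ `unitaryGroupOfForm σ J₀ ≤ GL₂(K)`, `B₀ σ 2 x y = σx₀·y₁ + σx₁·y₀`, `e_i = Pi.single i 1`, `n(t) = (1, t; 0, 1)`, `d(z) = diag(z, (σz)⁻¹)`.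
* §1 `B₀_two_apply`; `exists_units_coe_eq_lineUnipotent`; **`mem_unitaryGroupOfForm_iff_of_coe_eq_lineUnipotent`** — `n(t) ∈ U(σ, J₀) ↔ σt + t = 0`
  ([Rogawski1990] §1.9: `U(2)` relative to `Φ₂`; the tree's ★ `UnitaryGroupLineUnipotentTwo` «`b + c b = 0`»).
* §2 `exists_units_coe_eq_torusEltTwo`, `torusEltTwo_mem_unitaryGroupOfForm`, **`coe_torusEltTwo_conj_lineUnipotent`** — `d(z) n(t) d(z)⁻¹ = n(zσz·t)`.
* §3 **`B₀_apply_conj_lineUnipotent_sub_one_mulVec`** — the invariant `B₀(x, (k n(t) k⁻¹ − 1)x) = t·σa·a`, `a = (k⁻¹x)₁`; `range_B₀_conj_lineUnipotent_sub_one_mulVec`;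
  **`exists_conj_lineUnipotent_eq_iff_exists_norm_mul`** — for `t ≠ 0`, `σ² = 1`: `n(t) ∼_U n(t′) ↔ ∃ z ≠ 0, t′ = zσz·t` («the class is `t mod N E^×`»).
* §4 `antidiagPermTwo_mem_unitaryGroupOfForm` (flip `e₀ ↔ e₁`); **`exists_mem_unitaryGroupOfForm_mulVec_single_eq_two`** — `U(σ, J₀)` is transitive on the
  non-zero isotropic vectors of `K²` (★ `transvEquiv` at `N = 2`); **`exists_coe_eq_lineUnipotent_of_mulVec_single`** — a unipotent `g ∈ U` with `g e₀ ∈ K e₀`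
  is some `n(t)`; **MAIN `exists_conj_coe_eq_lineUnipotent`** — EVERY unipotent `u ∈ U(σ, J₀)` (`u − 1` nilpotent) is `U`-conjugate to some `n(t)`, `σt + t = 0`
  (★ rank-free `exists_isotropic_fixed_of_isNilpotent`).  Hence the unipotent classes of `U(Φ₂)(F)` are `{1}` and the `n(t)`, `t ∈ (E⁰ ∖ 0)∕N E^×` — for a
  non-split `p`-adic place two non-trivial classes `u_±`.

## References
* [Rogawski1990] J. D. Rogawski, *Automorphic Representations of Unitary Groups in Three Variables*, Ann. of Math. Stud. 123 (1990): §1.9 p. 8–9 (`U(2)`, `Φ₂`),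
  §1.10 p. 9, §3.9 p. 32 (the method: «conjugacy class of `n(t)` determined by `t mod NE^*`»), §4.9 p. 54 (`H = U(2) × U(1)`).
* [Tits1979] J. Tits, *Reductive groups over local fields*, PSPUM 33.1 (1979), §3.3.3 (unitary transvections; the tree's ★ `transv`).
* [Mok2014] C. P. Mok, *Endoscopic classification of representations of quasi-split unitary groups*, Mem. AMS 235 (2015): §1 Notation p. 5 (the form `J_N`).
-/

set_option autoImplicit false

open Matrix

namespace Literature.NumberTheory.Automorphic.UnitaryGroup

open Literature.NumberTheory.Automorphic.HermitianLattice

variable {K : Type*} [Field K] (σ : K →+* K)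

/-! ## §1 The form `B₀` on `K²` and the unipotent `n(t) = 1 + t·E₀₁` -/

/-- `B₀` on `K²` in coordinates: `B₀ x y = σx₀·y₁ + σx₁·y₀`. [cite: Mok2014, §1 Notation p. 5] -/
theorem B₀_two_apply (x y : Fin 2 → K) : B₀ σ 2 x y = σ (x 0) * y 1 + σ (x 1) * y 0 := by
  rw [B₀_apply, Fin.sum_univ_two]
  rfl

/-- `n(t) = 1 + t·E₀₁` is a unit of `M₂(K)` with inverse `n(−t)`. [cite: Rogawski1990, §1.10 p. 9] -/
theorem exists_units_coe_eq_lineUnipotent (t : K) :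
    ∃ u : GL (Fin 2) K, (u : Matrix (Fin 2) (Fin 2) K) = !![1, t; 0, 1] ∧ ((u⁻¹ : GL (Fin 2) K) : Matrix (Fin 2) (Fin 2) K) = !![1, -t; 0, 1] := by
  have h1 : (!![1, t; 0, 1] : Matrix (Fin 2) (Fin 2) K) * !![1, -t; 0, 1] = 1 := by
    ext i j; fin_cases i <;> fin_cases j <;> simp [Matrix.mul_apply, Fin.sum_univ_two]
  have h2 : (!![1, -t; 0, 1] : Matrix (Fin 2) (Fin 2) K) * !![1, t; 0, 1] = 1 := by
    ext i j; fin_cases i <;> fin_cases j <;> simp [Matrix.mul_apply, Fin.sum_univ_two]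
  exact ⟨⟨_, _, h1, h2⟩, rfl, rfl⟩

/-- The action of `n(t)`: `(n(t)·x)₀ = x₀ + t·x₁`, `(n(t)·x)₁ = x₁`. [cite: Rogawski1990, §1.10 p. 9] -/
theorem lineUnipotent_mulVec (t : K) (x : Fin 2 → K) :
    ((!![1, t; 0, 1] : Matrix (Fin 2) (Fin 2) K) *ᵥ x) 0 = x 0 + t * x 1 ∧ ((!![1, t; 0, 1] : Matrix (Fin 2) (Fin 2) K) *ᵥ x) 1 = x 1 := by
  constructor <;> simp [Matrix.mulVec, dotProduct, Fin.sum_univ_two]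

/-- `(n(t) − 1)·y = (t·y₁)·e₀`. [cite: Rogawski1990, §1.10 p. 9] -/
theorem lineUnipotent_sub_one_mulVec (t : K) (y : Fin 2 → K) :
    ((!![1, t; 0, 1] : Matrix (Fin 2) (Fin 2) K) - 1) *ᵥ y = Pi.single 0 (t * y 1) := by
  ext i
  fin_cases i <;> simp [Matrix.mulVec, dotProduct, Fin.sum_univ_two, Matrix.one_apply]

/-- **`n(t) ∈ U(σ, J₀)` iff `σt + t = 0`** (`t ∈ E⁰`): `B₀(n(t)x, n(t)y) = B₀(x, y) + (σt + t)·σx₁·y₁`.  (The tree's ★ `UnitaryGroupLineUnipotentTwo`: «`n(b) = 1 + b E₀₁`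
with `b + c b = 0`».) [cite: Rogawski1990, §1.9 p. 8] -/
theorem mem_unitaryGroupOfForm_iff_of_coe_eq_lineUnipotent {t : K} {u : GL (Fin 2) K} (hu : (u : Matrix (Fin 2) (Fin 2) K) = !![1, t; 0, 1]) :
    u ∈ unitaryGroupOfForm σ ((StdForm.antidiagonal 2).over K) ↔ σ t + t = 0 := by
  rw [mem_unitaryGroupOfForm_antidiagonal_iff, hu]
  have key : ∀ x y : Fin 2 → K,
      B₀ σ 2 ((!![1, t; 0, 1] : Matrix (Fin 2) (Fin 2) K) *ᵥ x) ((!![1, t; 0, 1] : Matrix (Fin 2) (Fin 2) K) *ᵥ y) = B₀ σ 2 x y + (σ t + t) * (σ (x 1) * y 1) := by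
    intro x y
    obtain ⟨hx0, hx1⟩ := lineUnipotent_mulVec t x
    obtain ⟨hy0, hy1⟩ := lineUnipotent_mulVec t y
    rw [B₀_two_apply, B₀_two_apply, hx0, hx1, hy0, hy1, map_add, map_mul]
    ring
  constructor
  · intro h
    have h1 := h (Pi.single 1 1) (Pi.single 1 1)
    rw [key] at h1
    simpa using h1
  · intro h x y
    rw [key, h, zero_mul, add_zero]

/-! ## §2 The torus `d(z) = diag(z, (σz)⁻¹)` -/

/-- `d(z) = diag(z, (σz)⁻¹)` (`z ≠ 0`) is a unit of `M₂(K)` with inverse `diag(z⁻¹, σz)`. [cite: Rogawski1990, §1.9 p. 8] -/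
theorem exists_units_coe_eq_torusEltTwo {z : K} (hz : z ≠ 0) :
    ∃ d : GL (Fin 2) K, (d : Matrix (Fin 2) (Fin 2) K) = Matrix.diagonal ![z, (σ z)⁻¹] ∧
      ((d⁻¹ : GL (Fin 2) K) : Matrix (Fin 2) (Fin 2) K) = Matrix.diagonal ![z⁻¹, σ z] := by
  have hσz : σ z ≠ 0 := (map_ne_zero σ).2 hz
  have h1 : Matrix.diagonal ![z, (σ z)⁻¹] * Matrix.diagonal ![z⁻¹, σ z] = 1 := by
    rw [Matrix.diagonal_mul_diagonal, ← Matrix.diagonal_one]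
    congr 1; funext i; fin_cases i <;> simp [mul_inv_cancel₀ hz, inv_mul_cancel₀ hσz]
  have h2 : Matrix.diagonal ![z⁻¹, σ z] * Matrix.diagonal ![z, (σ z)⁻¹] = 1 := by
    rw [Matrix.diagonal_mul_diagonal, ← Matrix.diagonal_one]
    congr 1; funext i; fin_cases i <;> simp [mul_inv_cancel₀ hσz, inv_mul_cancel₀ hz]
  exact ⟨⟨_, _, h1, h2⟩, rfl, rfl⟩

/-- **`d(z) ∈ U(σ, J₀)`** when `σ(σz) = z`. [cite: Rogawski1990, §1.9 p. 8] -/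
theorem torusEltTwo_mem_unitaryGroupOfForm {z : K} (hz : z ≠ 0) (hσz : σ (σ z) = z) {d : GL (Fin 2) K}
    (hd : (d : Matrix (Fin 2) (Fin 2) K) = Matrix.diagonal ![z, (σ z)⁻¹]) :
    d ∈ unitaryGroupOfForm σ ((StdForm.antidiagonal 2).over K) := by
  have hσz0 : σ z ≠ 0 := (map_ne_zero σ).2 hz
  rw [mem_unitaryGroupOfForm_antidiagonal_iff, hd]
  intro x y
  rw [B₀_two_apply, B₀_two_apply]
  simp only [Matrix.mulVec_diagonal]
  have e0 : (![z, (σ z)⁻¹] : Fin 2 → K) 0 = z := rfl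
  have e1 : (![z, (σ z)⁻¹] : Fin 2 → K) 1 = (σ z)⁻¹ := rfl
  rw [e0, e1, map_mul, map_mul, map_inv₀, hσz]
  field_simp

/-- `d(z)·e₀ = z·e₀`. [cite: Rogawski1990, §1.9 p. 8] -/
theorem torusEltTwo_mulVec_single_zero (z : K) {d : GL (Fin 2) K} (hd : (d : Matrix (Fin 2) (Fin 2) K) = Matrix.diagonal ![z, (σ z)⁻¹]) :
    (d : Matrix (Fin 2) (Fin 2) K) *ᵥ Pi.single 0 1 = z • Pi.single 0 1 := by
  rw [hd, diagonal_mulVec_single_one]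
  rfl

/-- **The torus moves `t` by norms**: `d(z)·n(t)·d(z)⁻¹ = n(zσz·t)`. [cite: Rogawski1990, §3.9 p. 32] -/
theorem coe_torusEltTwo_conj_lineUnipotent {z t : K} (hz : z ≠ 0) {d u : GL (Fin 2) K}
    (hd : (d : Matrix (Fin 2) (Fin 2) K) = Matrix.diagonal ![z, (σ z)⁻¹]) (hd' : ((d⁻¹ : GL (Fin 2) K) : Matrix (Fin 2) (Fin 2) K) = Matrix.diagonal ![z⁻¹, σ z])
    (hu : (u : Matrix (Fin 2) (Fin 2) K) = !![1, t; 0, 1]) :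
    ((d * u * d⁻¹ : GL (Fin 2) K) : Matrix (Fin 2) (Fin 2) K) = !![1, z * σ z * t; 0, 1] := by
  have hσz0 : σ z ≠ 0 := (map_ne_zero σ).2 hz
  rw [Units.val_mul, Units.val_mul, hd, hu, hd']
  ext i j
  fin_cases i <;> fin_cases j <;> (simp [Matrix.mul_apply, Matrix.diagonal, hz, hσz0]; try ring)

/-! ## §3 The invariant `B₀(x, (u − 1)x) ∈ t·N(K)` and the classes `t mod N(K^×)` -/

/-- **The invariant of the class of `n(t)`**: for `k ∈ U(σ, J₀)`, `B₀(x, (k n(t) k⁻¹ − 1)·x) = t·(σa·a)` with `a = (k⁻¹·x)₁`. [cite: Rogawski1990, §3.9 p. 32] -/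
theorem B₀_apply_conj_lineUnipotent_sub_one_mulVec {t : K} {u k : GL (Fin 2) K}
    (hu : (u : Matrix (Fin 2) (Fin 2) K) = !![1, t; 0, 1]) (hk : k ∈ unitaryGroupOfForm σ ((StdForm.antidiagonal 2).over K)) (x : Fin 2 → K) :
    B₀ σ 2 x ((((k * u * k⁻¹ : GL (Fin 2) K) : Matrix (Fin 2) (Fin 2) K) - 1) *ᵥ x) =
      t * (σ ((((k⁻¹ : GL (Fin 2) K) : Matrix (Fin 2) (Fin 2) K) *ᵥ x) 1) * ((((k⁻¹ : GL (Fin 2) K) : Matrix (Fin 2) (Fin 2) K) *ᵥ x) 1)) := by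
  have hkk : (k : Matrix (Fin 2) (Fin 2) K) * ((k⁻¹ : GL (Fin 2) K) : Matrix (Fin 2) (Fin 2) K) = 1 := Units.mul_inv k
  have hinv := (mem_unitaryGroupOfForm_antidiagonal_iff (σ := σ) (N := 2) k).1 hk
  rw [coe_conj_sub_one, ← Matrix.mulVec_mulVec, ← Matrix.mulVec_mulVec, hu, lineUnipotent_sub_one_mulVec]
  set y : Fin 2 → K := ((k⁻¹ : GL (Fin 2) K) : Matrix (Fin 2) (Fin 2) K) *ᵥ x with hy
  have hx : x = (k : Matrix (Fin 2) (Fin 2) K) *ᵥ y := by rw [hy, Matrix.mulVec_mulVec, hkk, Matrix.one_mulVec]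
  rw [hx, hinv, B₀_two_apply, Pi.single_eq_same, Pi.single_eq_of_ne (by decide : (1 : Fin 2) ≠ 0), mul_zero, zero_add]
  ring

/-- **The value set `{B₀(x, (g − 1)x)}` of a conjugate `g = k n(t) k⁻¹` (`k ∈ U(σ, J₀)`) is `t·N(K) = {t·σa·a}`.** [cite: Rogawski1990, §3.9 p. 32] -/
theorem range_B₀_conj_lineUnipotent_sub_one_mulVec {t : K} {u k : GL (Fin 2) K}
    (hu : (u : Matrix (Fin 2) (Fin 2) K) = !![1, t; 0, 1]) (hk : k ∈ unitaryGroupOfForm σ ((StdForm.antidiagonal 2).over K)) :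
    Set.range (fun x : Fin 2 → K => B₀ σ 2 x ((((k * u * k⁻¹ : GL (Fin 2) K) : Matrix (Fin 2) (Fin 2) K) - 1) *ᵥ x)) =
      Set.range (fun a : K => t * (σ a * a)) := by
  have hkk : ((k⁻¹ : GL (Fin 2) K) : Matrix (Fin 2) (Fin 2) K) * (k : Matrix (Fin 2) (Fin 2) K) = 1 := Units.inv_mul k
  ext c
  constructor
  · rintro ⟨x, rfl⟩
    exact ⟨(((k⁻¹ : GL (Fin 2) K) : Matrix (Fin 2) (Fin 2) K) *ᵥ x) 1, (B₀_apply_conj_lineUnipotent_sub_one_mulVec σ hu hk x).symm⟩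
  · rintro ⟨a, rfl⟩
    refine ⟨(k : Matrix (Fin 2) (Fin 2) K) *ᵥ (Pi.single 1 a), ?_⟩
    beta_reduce
    rw [B₀_apply_conj_lineUnipotent_sub_one_mulVec σ hu hk, Matrix.mulVec_mulVec, hkk, Matrix.one_mulVec]
    simp

/-- **THE CLASS OF `n(t)` IN `U(Φ₂)` IS `t mod N E^×`**: for `t ≠ 0` and `σ` an involution, `n(t)` and `n(t′)` are `U(σ, J₀)`-conjugate iff `t′ = zσz·t` for some
`z ≠ 0` ((⇐) by `d(z)`; (⇒) by the invariant value sets). [cite: Rogawski1990, §3.9 p. 32] -/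
theorem exists_conj_lineUnipotent_eq_iff_exists_norm_mul (hσ : ∀ z : K, σ (σ z) = z) {t t' : K} (ht : t ≠ 0) {u u' : GL (Fin 2) K}
    (hu : (u : Matrix (Fin 2) (Fin 2) K) = !![1, t; 0, 1]) (hu' : (u' : Matrix (Fin 2) (Fin 2) K) = !![1, t'; 0, 1]) :
    (∃ k : GL (Fin 2) K, k ∈ unitaryGroupOfForm σ ((StdForm.antidiagonal 2).over K) ∧ k * u * k⁻¹ = u') ↔ ∃ z : K, z ≠ 0 ∧ t' = z * σ z * t := by
  constructor
  · rintro ⟨k, hk, hkuk⟩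
    have h1 := range_B₀_conj_lineUnipotent_sub_one_mulVec σ hu hk
    have h2 := range_B₀_conj_lineUnipotent_sub_one_mulVec σ hu' (one_mem _)
    rw [one_mul, inv_one, mul_one, ← hkuk, h1] at h2
    have ht' : t' ∈ Set.range (fun a : K => t * (σ a * a)) := by rw [h2]; exact ⟨1, by simp⟩
    have htm : t ∈ Set.range (fun a : K => t' * (σ a * a)) := by rw [← h2]; exact ⟨1, by simp⟩
    obtain ⟨a, ha⟩ := ht'
    obtain ⟨b, hb⟩ := htm
    beta_reduce at ha hb
    refine ⟨a, ?_, ?_⟩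
    · rintro rfl
      apply ht
      rw [map_zero, zero_mul, mul_zero] at ha
      rw [← hb, ← ha, zero_mul]
    · rw [← ha]; ring
  · rintro ⟨z, hz, ht'⟩
    obtain ⟨d, hd, hd'⟩ := exists_units_coe_eq_torusEltTwo σ hz
    refine ⟨d, torusEltTwo_mem_unitaryGroupOfForm σ hz (hσ z) hd, Units.ext ?_⟩
    rw [coe_torusEltTwo_conj_lineUnipotent σ hz hd hd' hu, hu', ht']

/-! ## §4 Every unipotent element of `U(Φ₂)` is conjugate to some `n(t)` -/

/-- The Weyl flip `antidiag(1, 1)` as a unit of `M₂(K)` (self-inverse). [cite: Rogawski1990, §1.9 p. 8] -/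
theorem exists_units_coe_eq_antidiagPermTwo :
    ∃ w : GL (Fin 2) K, (w : Matrix (Fin 2) (Fin 2) K) = !![0, 1; 1, 0] ∧ ((w⁻¹ : GL (Fin 2) K) : Matrix (Fin 2) (Fin 2) K) = !![0, 1; 1, 0] := by
  have h1 : (!![0, 1; 1, 0] : Matrix (Fin 2) (Fin 2) K) * !![0, 1; 1, 0] = 1 := by
    ext i j; fin_cases i <;> fin_cases j <;> simp [Matrix.mul_apply, Fin.sum_univ_two]
  exact ⟨⟨_, _, h1, h1⟩, rfl, rfl⟩

/-- **The Weyl flip lies in `U(σ, J₀)`**: `B₀(w x, w y) = σx₁·y₀ + σx₀·y₁ = B₀(x, y)`. [cite: Rogawski1990, §1.9 p. 8] -/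
theorem antidiagPermTwo_mem_unitaryGroupOfForm {w : GL (Fin 2) K} (hw : (w : Matrix (Fin 2) (Fin 2) K) = !![0, 1; 1, 0]) :
    w ∈ unitaryGroupOfForm σ ((StdForm.antidiagonal 2).over K) := by
  rw [mem_unitaryGroupOfForm_antidiagonal_iff, hw]
  intro x y
  rw [B₀_two_apply, B₀_two_apply]
  simp [Matrix.mulVec, dotProduct, Fin.sum_univ_two]
  ring

/-- **`U(σ, J₀)` is transitive on the non-zero isotropic vectors of `K²`** (`σ` an involution): `v ≠ 0`, `B₀(v, v) = 0` ⇒ `v = k e₀` with `k ∈ U(σ, J₀)`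
(`v₀ ≠ 0`: ★ transvection `e₀ ↦ v₀⁻¹v` after `d(v₀)`; `v₀ = 0`: flip after `d(v₁)`). [cite: Rogawski1990, §3.9 p. 32] [cite: Tits1979, §3.3.3] -/
theorem exists_mem_unitaryGroupOfForm_mulVec_single_eq_two (hσ : ∀ z : K, σ (σ z) = z) {v : Fin 2 → K} (hv : v ≠ 0) (hiso : B₀ σ 2 v v = 0) :
    ∃ k : GL (Fin 2) K, k ∈ unitaryGroupOfForm σ ((StdForm.antidiagonal 2).over K) ∧ (k : Matrix (Fin 2) (Fin 2) K) *ᵥ Pi.single 0 1 = v := by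
  by_cases hv0 : v 0 = 0
  · -- `v = v₁ e₁`, `k = w · d(v₁)`
    have hv1 : v = v 1 • Pi.single 1 1 := by
      ext i; fin_cases i <;> simp [hv0]
    have hz : v 1 ≠ 0 := by
      intro h
      apply hv
      rw [hv1, h, zero_smul]
    obtain ⟨d, hd, -⟩ := exists_units_coe_eq_torusEltTwo σ hz
    obtain ⟨w, hw, -⟩ := exists_units_coe_eq_antidiagPermTwo (K := K)
    refine ⟨w * d, mul_mem (antidiagPermTwo_mem_unitaryGroupOfForm σ hw) (torusEltTwo_mem_unitaryGroupOfForm σ hz (hσ _) hd), ?_⟩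
    rw [Units.val_mul, ← Matrix.mulVec_mulVec, torusEltTwo_mulVec_single_zero σ (v 1) hd, Matrix.mulVec_smul]
    conv_rhs => rw [hv1]
    congr 1
    ext i
    fin_cases i <;> simp [hw, Matrix.mulVec, dotProduct, Fin.sum_univ_two]
  · -- `x = v₀⁻¹ v`, `k = transv 0 x · d(v₀)`
    obtain ⟨x, hx⟩ : ∃ x : Fin 2 → K, (v 0)⁻¹ • v = x := ⟨_, rfl⟩
    have hx1 : x 0 = 1 := by rw [← hx, Pi.smul_apply, smul_eq_mul, inv_mul_cancel₀ hv0]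
    have hx0 : B₀ σ 2 x x = 0 := by rw [← hx]; exact B₀_smul_smul_self_eq_zero hiso _
    have hi : Fin.rev (0 : Fin 2) ≠ 0 := by decide
    obtain ⟨kT, hkT⟩ := exists_unitary_toLin_eq (σ := σ) (transvEquiv hσ hi hx1 hx0)
      (fun a b => by rw [transvEquiv_apply, transvEquiv_apply]; exact B₀_transv hσ hi hx1 hx0 a b)
    obtain ⟨d, hd, -⟩ := exists_units_coe_eq_torusEltTwo σ hv0
    refine ⟨(kT : GL (Fin 2) K) * d, mul_mem kT.2 (torusEltTwo_mem_unitaryGroupOfForm σ hv0 (hσ _) hd), ?_⟩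
    rw [Units.val_mul, ← Matrix.mulVec_mulVec, torusEltTwo_mulVec_single_zero σ (v 0) hd, Matrix.mulVec_smul, ← Matrix.toLin'_apply, hkT,
      LinearEquiv.coe_coe, transvEquiv_apply, transv_single_self hi, ← hx, smul_smul, mul_inv_cancel₀ hv0, one_smul]

/-- **A unipotent `g ∈ U(σ, J₀)` with `g e₀ ∈ K e₀` is some `n(t)`**: the column `g e₀ = c e₀`; `(g − 1)^n e₀ = (c − 1)^n e₀ = 0` gives `c = 1`; and
`B₀(g e₀, g e₁) = B₀(e₀, e₁) = 1` gives `σc·g₁₁ = 1`, so `g₁₁ = 1`. [cite: Rogawski1990, §3.9 p. 32] -/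
theorem exists_coe_eq_lineUnipotent_of_mulVec_single {g : GL (Fin 2) K} (hg : g ∈ unitaryGroupOfForm σ ((StdForm.antidiagonal 2).over K)) {c : K}
    (he : (g : Matrix (Fin 2) (Fin 2) K) *ᵥ Pi.single 0 1 = c • Pi.single 0 1) (hnil : IsNilpotent ((g : Matrix (Fin 2) (Fin 2) K) - 1)) :
    ∃ t : K, (g : Matrix (Fin 2) (Fin 2) K) = !![1, t; 0, 1] := by
  set G : Matrix (Fin 2) (Fin 2) K := (g : Matrix (Fin 2) (Fin 2) K) with hG
  have hinv := (mem_unitaryGroupOfForm_antidiagonal_iff (σ := σ) (N := 2) g).1 hg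
  have hcol : ∀ i, G i 0 = (c • (Pi.single 0 1 : Fin 2 → K)) i := fun i => by
    rw [← he, Matrix.mulVec_single_one]; rfl
  have h00 : G 0 0 = c := by rw [hcol]; simp
  have h10 : G 1 0 = 0 := by rw [hcol]; simp
  have hGe : ∀ i j, (G *ᵥ Pi.single j 1) i = G i j := fun i j => by rw [Matrix.mulVec_single_one]; rfl
  -- `B₀(g e₀, g e₁) = 1` ⇒ `σc · G₁₁ = 1`
  have h01 : σ c * G 1 1 = 1 := by
    have h := hinv (Pi.single 0 1) (Pi.single 1 1)
    rw [B₀_two_apply, B₀_two_apply, he, hGe, hGe] at h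
    simpa using h
  -- `c = 1`
  obtain ⟨n, hn⟩ := hnil
  have hA0 : (G - 1) *ᵥ Pi.single 0 1 = (c - 1) • (Pi.single 0 1 : Fin 2 → K) := by
    rw [Matrix.sub_mulVec, Matrix.one_mulVec, he, sub_smul, one_smul]
  have hc1 : c = 1 := by
    have h := congr_fun (pow_mulVec_of_mulVec_eq_smul hA0 n) 0
    rw [hn, Matrix.zero_mulVec] at h
    simp only [Pi.zero_apply, Pi.smul_apply, Pi.single_eq_same, smul_eq_mul, mul_one] at h
    exact sub_eq_zero.1 (pow_eq_zero_iff'.mp h.symm).1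
  have h11 : G 1 1 = 1 := by rwa [hc1, map_one, one_mul] at h01
  refine ⟨G 0 1, ?_⟩
  ext i j
  fin_cases i <;> fin_cases j <;> simp [h00, hc1, h10, h11]

/-- **EVERY UNIPOTENT ELEMENT OF `U(Φ₂)` IS CONJUGATE TO SOME `n(t)`, `t ∈ E⁰`** (`σ` an involution): for `u ∈ U(σ, J₀)` with `u − 1` nilpotent there are
`k ∈ U(σ, J₀)` and `t` with `σt + t = 0` and `k u k⁻¹ = n(t)`.  (`u` fixes a non-zero isotropic vector — ★ rank-free `exists_isotropic_fixed_of_isNilpotent` —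
which `U` moves to `e₀`; the conjugate then stabilises `K e₀` and is unipotent.)  With §3 the unipotent classes of `U(Φ₂)` are `{1}` and the `n(t)`,
`t ∈ (E⁰ ∖ 0) ∕ N E^×`. [cite: Rogawski1990, §3.9 p. 32] -/
theorem exists_conj_coe_eq_lineUnipotent (hσ : ∀ z : K, σ (σ z) = z) {u : GL (Fin 2) K} (hu : u ∈ unitaryGroupOfForm σ ((StdForm.antidiagonal 2).over K))
    (hnil : IsNilpotent ((u : Matrix (Fin 2) (Fin 2) K) - 1)) :
    ∃ k : GL (Fin 2) K, k ∈ unitaryGroupOfForm σ ((StdForm.antidiagonal 2).over K) ∧ ∃ t : K, σ t + t = 0 ∧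
      ((k * u * k⁻¹ : GL (Fin 2) K) : Matrix (Fin 2) (Fin 2) K) = !![1, t; 0, 1] := by
  obtain ⟨k, hk, he⟩ : ∃ k : GL (Fin 2) K, k ∈ unitaryGroupOfForm σ ((StdForm.antidiagonal 2).over K) ∧
      ((k * u * k⁻¹ : GL (Fin 2) K) : Matrix (Fin 2) (Fin 2) K) *ᵥ Pi.single 0 1 = (1 : K) • (Pi.single 0 1 : Fin 2 → K) := by
    by_cases h1 : u = 1
    · exact ⟨1, one_mem _, by rw [h1, inv_one, mul_one, mul_one, Units.val_one, Matrix.one_mulVec, one_smul]⟩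
    obtain ⟨v, hv, hfix, hiso⟩ := exists_isotropic_fixed_of_isNilpotent σ hu hnil h1
    obtain ⟨k₀, hk₀, hk₀v⟩ := exists_mem_unitaryGroupOfForm_mulVec_single_eq_two σ hσ hv hiso
    refine ⟨k₀⁻¹, inv_mem hk₀, ?_⟩
    have hkk : ((k₀⁻¹ : GL (Fin 2) K) : Matrix (Fin 2) (Fin 2) K) * (k₀ : Matrix (Fin 2) (Fin 2) K) = 1 := Units.inv_mul k₀
    rw [inv_inv, Units.val_mul, Units.val_mul, ← Matrix.mulVec_mulVec, ← Matrix.mulVec_mulVec, hk₀v, hfix, ← hk₀v, Matrix.mulVec_mulVec, hkk,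
      Matrix.one_mulVec, one_smul]
  have hmem : k * u * k⁻¹ ∈ unitaryGroupOfForm σ ((StdForm.antidiagonal 2).over K) := mul_mem (mul_mem hk hu) (inv_mem hk)
  obtain ⟨t, hshape⟩ := exists_coe_eq_lineUnipotent_of_mulVec_single σ hmem he (isNilpotent_coe_conj_sub_one k hnil)
  exact ⟨k, hk, t, (mem_unitaryGroupOfForm_iff_of_coe_eq_lineUnipotent σ hshape).1 hmem, hshape⟩

end Literature.NumberTheory.Automorphic.UnitaryGroup
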